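import Summits.HodgeConjecture.CorCM.SexticOcticSlotOrbitVector
import HarnessLib

/-!
# A sextic slot against an octic slot, VI: a three-dimensional common constituent makes the fixed point a REFLEX
# embedding — `Stab(y₀) = Stab(Φ₊)`

COR-CM (cell `pub-hodgecm2`, binder seat `b16` gen 47, count-neutral claim CM34-COMPLETE, file F6; theorems only, no
definition, no named fact, no `sorry`).  Setting of F5 (`SexticOcticSlotOrbitVector`): frames `e`, `e'` of an element
`c` of order three, `G` transitive on `Y` and commuting with `ρ`, a common constituent `(P, T)` with `dim P = 3`, the
orbit vector `a` (values `(1,1,1,−1,−1,−1)` on `e`, i.e. the type vector of `Φ₊ = {x₀, cx₀, c²x₀}`) with image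
`t = Ta = (α, −α, β, β, β, −β, −β, −β)` on `e'`, `α ≠ 0`, `β ≠ 0`, and the trace identity `3·a(Tf) = s(f)·α`,
`3·S(Tf) = s(f)·3β`.

* §1 **`orbitVec_comp_eq_of_smul_eq`** (`Stab(y₀) ≤ Stab(Φ₊)`): if `g y₀ = y₀` then `f = a∘g − a` has `a(Tf) = 0`,
  hence `s(f) = 0` and `S(t∘g) = S(t) = 3β`; the three values `t(g cʲy₁) ∈ {±β}` must all be `β`, so `t∘g = t` on
  the frame, `T(a∘g − a) = 0`, `a∘g = a`.
* §2 **`smul_eq_of_orbitVec_comp_eq`** (`Stab(Φ₊) ≤ Stab(y₀)`): if `a∘k = a` then `t∘k = t`, so `t(k y₀) = α`; `k y₀ = ρy₀`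
  gives `α = 0`; `k y₀ ∈ {cʲy₁}` (resp. `{ρcʲy₁}`) gives `α = β` (resp. `−β`) — after replacing `k` by `cᵐk`, `k y₀ = y₁`
  (resp. `ρy₁`) — and then the pair difference `v = v₀ − v₁ ∈ T(P)` of F5 (resp. `−v`) has a `k`-translate with
  `a = 1` and `S = 3·a = 3`, i.e. three DISTINCT points `k y₁, k cy₁, k c²y₁` inside the two-point set `{v = 1}` —
  impossible (`sum_translate_ne_three`).
* §3 **`smul_eq_iff_forall_mem_orbitType_iff`**: `g y₀ = y₀ ⟺ ∀ x, (g x ∈ Φ₊ ↔ x ∈ Φ₊)` — `y₀` is a REFLEX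
  EMBEDDING for the orbit type (Shimura's `Fix(ψ₀) = Stab(Φ)`).

## References

* [Shimura1998] G. Shimura, *Abelian Varieties with Complex Multiplication and Modular Functions*, §8.3 Prop. 28.
* [Dodson1984] B. Dodson, *The structure of Galois groups of CM-fields*, Trans. AMS 283 (1984), §1.1, §5.1.1–§5.1.2.
-/

noncomputable section

namespace Summit.HodgeConjecture.CorCM.SexticOctic

open Literature.NumberTheory.ComplexMultiplication

variable {G : Type*} [Group G] {X Y : Type*} [MulAction G X] [MulAction G Y] {ρ : G}
variable {e : Fin 6 → X} {c : G} {e' : Fin 8 → Y} {P : Submodule ℚ (X → ℚ)} {T : (X → ℚ) →ₗ[ℚ] (Y → ℚ)}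
  {a : X → ℚ}

/-! ## §0 Two counting lemmas on indices -/

/-- Three numbers from `{β, −β}` (`β ≠ 0`) with sum `3β` are all `β`. [folklore] -/
theorem eq_of_sum_eq_three_mul {β x y z : ℚ} (hβ : β ≠ 0) (hx : x = β ∨ x = -β) (hy : y = β ∨ y = -β)
    (hz : z = β ∨ z = -β) (h : x + y + z = 3 * β) : x = β ∧ y = β ∧ z = β := by
  rcases hx with hx | hx <;> rcases hy with hy | hy <;> rcases hz with hz | hz <;>
    first
    | exact ⟨hx, hy, hz⟩
    | exact absurd (show β = 0 by subst hx hy hz; linarith) hβ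

/-- **Pigeonhole for the pair difference `v = v₀ − v₁`** (frame values `(0, 0, 1, −1, 0, −1, 1, 0)`): for an injective
index map `π`, `v(π 2) + v(π 3) + v(π 4) ≠ 3` — the value `1` is taken at two indices only. [folklore] -/
theorem sum_translate_ne_three {π : Fin 8 → Fin 8} (hπ : Function.Injective π) :
    (![0, 0, 1, -1, 0, -1, 1, 0] : Fin 8 → ℚ) (π 2) + ![0, 0, 1, -1, 0, -1, 1, 0] (π 3) +
      ![0, 0, 1, -1, 0, -1, 1, 0] (π 4) ≠ 3 := by
  have hle : ∀ j : Fin 8, (![0, 0, 1, -1, 0, -1, 1, 0] : Fin 8 → ℚ) j ≤ 1 := by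
    intro j; fin_cases j <;> simp
  have hone : ∀ j : Fin 8, (![0, 0, 1, -1, 0, -1, 1, 0] : Fin 8 → ℚ) j = 1 → j = 2 ∨ j = 6 := by
    intro j; fin_cases j <;> simp <;> decide
  intro h
  have h2 : (![0, 0, 1, -1, 0, -1, 1, 0] : Fin 8 → ℚ) (π 2) = 1 := by
    linarith [hle (π 2), hle (π 3), hle (π 4)]
  have h3 : (![0, 0, 1, -1, 0, -1, 1, 0] : Fin 8 → ℚ) (π 3) = 1 := by
    linarith [hle (π 2), hle (π 3), hle (π 4)]
  have h4 : (![0, 0, 1, -1, 0, -1, 1, 0] : Fin 8 → ℚ) (π 4) = 1 := by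
    linarith [hle (π 2), hle (π 3), hle (π 4)]
  rcases hone _ h2 with a2 | a2 <;> rcases hone _ h3 with a3 | a3 <;> rcases hone _ h4 with a4 | a4
  all_goals first
    | exact absurd (hπ (a2.trans a3.symm)) (by decide)
    | exact absurd (hπ (a2.trans a4.symm)) (by decide)
    | exact absurd (hπ (a3.trans a4.symm)) (by decide)

/-! ## §1 `Stab(y₀) ≤ Stab(Φ₊)` -/

/-- **If `g` fixes `y₀` then `g` fixes the orbit vector**: `a∘g = a`. [cite: Shimura1998, §8.3 Prop. 28]
[cite: Dodson1984, §5.1.1] -/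
theorem orbitVec_comp_eq_of_smul_eq [MulAction.IsPretransitive G Y] (hsurj : Function.Surjective e)
    (hρe : ∀ i, ρ • e i = e (![3, 4, 5, 0, 1, 2] i)) (hce : ∀ i, c • e i = e (![1, 2, 0, 4, 5, 3] i))
    (he' : Function.Injective e') (hsurj' : Function.Surjective e')
    (hρe' : ∀ i, ρ • e' i = e' (![1, 0, 5, 6, 7, 2, 3, 4] i)) (hce' : ∀ i, c • e' i = e' (![0, 1, 3, 4, 2, 6, 7, 5] i))
    (hcomm : ∀ (g : G) (y : Y), g • ρ • y = ρ • g • y)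
    (hPanti : P ≤ antiWeights (E := X) ρ) (hPst : ∀ g : G, ∀ f ∈ P, (fun x => f (g • x)) ∈ P)
    (hT : ∀ g : G, ∀ f ∈ P, T (fun x => f (g • x)) = fun y => T f (g • y))
    (hTanti : ∀ f ∈ P, T f ∈ antiWeights (E := Y) ρ) (hTinj : ∀ f ∈ P, T f = 0 → f = 0)
    (ha : ∀ i, a (e i) = ![1, 1, 1, -1, -1, -1] i) (haP : a ∈ P) {g : G} (hg : g • e' 0 = e' 0) :
    (fun x => a (g • x)) = a := by
  have hα := apply_map_orbitVec_ne_zero hsurj hρe hce hsurj' hce' hPanti hPst hT hTinj ha haP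
  have hβ3 := sum_map_orbitVec_ne_zero hsurj hρe hce he' hsurj' hρe' hce' hcomm hPanti hPst hT hTanti hTinj ha haP
  have hval := apply_map_orbitVec_frame hsurj hce hρe' hce' hT hTanti ha haP
  set α := T a (e' 0) with hαdef
  set β := T a (e' 2) with hβdef
  have hv3 : T a (e' 3) = β := by simpa using hval 3
  have hv4 : T a (e' 4) = β := by simpa using hval 4
  have hβ : β ≠ 0 := by intro h; apply hβ3; rw [hv3, hv4, h]; ring
  obtain ⟨π, hπ, hπinj, hπr⟩ := exists_indexMap he' hsurj' hρe' hcomm g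
  have hπ0 : π 0 = 0 := he' (by rw [← hπ 0, hg])
  have hπ1 : π 1 = 1 := by have := hπr 0; simp only [Matrix.cons_val] at this; rw [this, hπ0]; rfl
  have hne : ∀ i : Fin 8, i ≠ 0 → i ≠ 1 → π i ≠ 0 ∧ π i ≠ 1 := fun i hi0 hi1 =>
    ⟨fun h => hi0 (hπinj (h.trans hπ0.symm)), fun h => hi1 (hπinj (h.trans hπ1.symm))⟩
  have hpm : ∀ i : Fin 8, i ≠ 0 → i ≠ 1 → T a (e' (π i)) = β ∨ T a (e' (π i)) = -β := by
    intro i hi0 hi1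
    obtain ⟨h0, h1⟩ := hne i hi0 hi1
    rw [hval (π i)]
    generalize π i = k at h0 h1 ⊢
    fin_cases k <;> simp at h0 h1 ⊢
  -- `f = a∘g − a` has `a(Tf) = 0`, hence `s(f) = 0` and `S(Tf) = 0`
  have hfP : (fun x => a (g • x)) - a ∈ P := P.sub_mem (hPst g a haP) haP
  have hTf : T ((fun x => a (g • x)) - a) = (fun y => T a (g • y)) - T a := by rw [map_sub, hT g a haP]
  obtain ⟨htr1, htr2⟩ := trace_identity hsurj hρe hce hce' hPanti hPst hT ha haP hfP
  rw [hTf] at htr1 htr2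
  simp only [Pi.sub_apply, hg, sub_self, mul_zero] at htr1
  have hs0 : ((fun x => a (g • x)) - a) (e 0) + ((fun x => a (g • x)) - a) (e 1) +
      ((fun x => a (g • x)) - a) (e 2) = 0 := by
    rcases mul_eq_zero.1 htr1.symm with h | h
    · exact h
    · exact absurd h hα
  rw [hs0, zero_mul] at htr2
  simp only [Pi.sub_apply] at htr2
  rw [hπ, hπ, hπ, hv3, hv4] at htr2
  -- the three values `t(e' (π i))`, `i = 2, 3, 4`, sum to `3β`
  have hsum : T a (e' (π 2)) + T a (e' (π 3)) + T a (e' (π 4)) = 3 * β := by linarith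
  obtain ⟨q2, q3, q4⟩ := eq_of_sum_eq_three_mul hβ (hpm 2 (by decide) (by decide)) (hpm 3 (by decide) (by decide))
    (hpm 4 (by decide) (by decide)) hsum
  -- hence `t ∘ g = t`, so `T(a∘g − a) = 0`
  have heq : (fun y => T a (g • y)) = T a := by
    refine eq_of_frame₈ hsurj' hρe' (comp_smul_mem_antiWeights hcomm (hTanti a haP) g) (hTanti a haP)
      ?_ ?_ ?_ ?_
    · simp only [hg]
    · simp only [hπ, q2, hβdef]
    · simp only [hπ, q3, hv3]
    · simp only [hπ, q4, hv4]
  have h0 : T ((fun x => a (g • x)) - a) = 0 := by rw [hTf, heq, sub_self]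
  exact sub_eq_zero.1 (hTinj _ hfP h0)

/-! ## §2 `Stab(Φ₊) ≤ Stab(y₀)` -/

/-- **The key exclusion**: no `k ∈ G` fixing the orbit vector sends `y₀` to `y₁` or to `ρy₁`.  (Then `α = ±β`, and the
pair difference `±v ∈ T(P)` has a `k`-translate with `a = 1`, `S = 3` — three distinct points in a two-point set.)
[cite: Dodson1984, §5.1.1] -/
theorem smul_ne_of_orbitVec_comp_eq [MulAction.IsPretransitive G Y] [DecidableEq Y]
    (hsurj : Function.Surjective e) (hρe : ∀ i, ρ • e i = e (![3, 4, 5, 0, 1, 2] i))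
    (hce : ∀ i, c • e i = e (![1, 2, 0, 4, 5, 3] i)) (he' : Function.Injective e')
    (hsurj' : Function.Surjective e') (hρe' : ∀ i, ρ • e' i = e' (![1, 0, 5, 6, 7, 2, 3, 4] i))
    (hce' : ∀ i, c • e' i = e' (![0, 1, 3, 4, 2, 6, 7, 5] i)) (hcomm : ∀ (g : G) (y : Y), g • ρ • y = ρ • g • y)
    (hPanti : P ≤ antiWeights (E := X) ρ) (hPst : ∀ g : G, ∀ f ∈ P, (fun x => f (g • x)) ∈ P)
    (hT : ∀ g : G, ∀ f ∈ P, T (fun x => f (g • x)) = fun y => T f (g • y))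
    (hTanti : ∀ f ∈ P, T f ∈ antiWeights (E := Y) ρ) (hTinj : ∀ f ∈ P, T f = 0 → f = 0)
    (h3 : Module.finrank ℚ P = 3) (ha : ∀ i, a (e i) = ![1, 1, 1, -1, -1, -1] i) (haP : a ∈ P) {k : G}
    (hk : (fun x => a (k • x)) = a) : k • e' 0 ≠ e' 2 ∧ k • e' 0 ≠ e' 5 := by
  have hα := apply_map_orbitVec_ne_zero hsurj hρe hce hsurj' hce' hPanti hPst hT hTinj ha haP
  have hval := apply_map_orbitVec_frame hsurj hce hρe' hce' hT hTanti ha haP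
  set α := T a (e' 0) with hαdef
  set β := T a (e' 2) with hβdef
  have hv3 : T a (e' 3) = β := by simpa using hval 3
  have hv4 : T a (e' 4) = β := by simpa using hval 4
  have hv5 : T a (e' 5) = -β := by simpa using hval 5
  -- `t ∘ k = t`
  have htk : ∀ y, T a (k • y) = T a y := fun y => by
    have h := hT k a haP
    rw [hk] at h
    exact (congrFun h y).symm
  -- the pair difference `v ∈ T(P)` and its frame values
  obtain ⟨pv, hpvP, hpv⟩ := (Submodule.mem_map).1 (single_sub_single_sub_mem_map hsurj hρe hce he' hsurj' hρe' hce'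
    hPanti hPst hT hTanti hTinj (by omega))
  have hvval : ∀ i, T pv (e' i) = (![0, 0, 1, -1, 0, -1, 1, 0] : Fin 8 → ℚ) i := by
    intro i
    rw [hpv]
    simp only [Pi.sub_apply, single_frame_apply he']
    fin_cases i <;> simp
  obtain ⟨π, hπ, hπinj, -⟩ := exists_indexMap he' hsurj' hρe' hcomm k
  -- the trace identity for `±pv ∘ k`
  have key : ∀ (ε : ℚ) (j : Fin 8), ε * ε = 1 → k • e' 0 = e' j → T a (e' j) = ε * β →
      ε * (![0, 0, 1, -1, 0, -1, 1, 0] : Fin 8 → ℚ) j = 1 → False := by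
    intro ε j hε hkj htj hvj
    -- `α = ε β`
    have hαβ : α = ε * β := by rw [hαdef, ← htk (e' 0), hkj, htj]
    have hfP : (fun x => (ε • pv) (k • x)) ∈ P := hPst k _ (P.smul_mem ε hpvP)
    obtain ⟨htr1, htr2⟩ := trace_identity hsurj hρe hce hce' hPanti hPst hT ha haP hfP
    rw [hT k _ (P.smul_mem ε hpvP), map_smul] at htr1 htr2
    simp only [Pi.smul_apply, smul_eq_mul] at htr1 htr2
    rw [hkj, hvval, hvj, ← hαdef, hαβ] at htr1
    rw [hπ, hπ, hπ, hvval, hvval, hvval, hv3, hv4] at htr2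
    -- from `3 = s·εβ` and `3ε·V = 3sβ`: `V = 3`
    have hS : (![0, 0, 1, -1, 0, -1, 1, 0] : Fin 8 → ℚ) (π 2) + ![0, 0, 1, -1, 0, -1, 1, 0] (π 3) +
        ![0, 0, 1, -1, 0, -1, 1, 0] (π 4) = 3 := by
      linear_combination (ε / 3) * htr2 - htr1 -
        ((![0, 0, 1, -1, 0, -1, 1, 0] : Fin 8 → ℚ) (π 2) + ![0, 0, 1, -1, 0, -1, 1, 0] (π 3) +
          ![0, 0, 1, -1, 0, -1, 1, 0] (π 4)) * hε
    exact sum_translate_ne_three hπinj hS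
  constructor
  · intro hk2
    exact key 1 2 (by norm_num) hk2 (by simp [hβdef]) (by simp)
  · intro hk5
    exact key (-1) 5 (by norm_num) hk5 (by rw [hv5]; ring) (by simp)

/-- **If `k` fixes the orbit vector then `k` fixes `y₀`** (`Stab(Φ₊) ≤ Stab(y₀)`): `t∘k = t` puts `k y₀` among the
points where `t = α`; `ρy₀` would give `α = 0`, and the six points off the fixed pair are excluded by
`smul_ne_of_orbitVec_comp_eq` applied to `k`, `ck` or `c²k`. [cite: Shimura1998, §8.3 Prop. 28] [cite: Dodson1984, §5.1.1] -/
theorem smul_eq_of_orbitVec_comp_eq [MulAction.IsPretransitive G Y] [DecidableEq Y]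
    (hsurj : Function.Surjective e) (hρe : ∀ i, ρ • e i = e (![3, 4, 5, 0, 1, 2] i))
    (hce : ∀ i, c • e i = e (![1, 2, 0, 4, 5, 3] i)) (he' : Function.Injective e')
    (hsurj' : Function.Surjective e') (hρe' : ∀ i, ρ • e' i = e' (![1, 0, 5, 6, 7, 2, 3, 4] i))
    (hce' : ∀ i, c • e' i = e' (![0, 1, 3, 4, 2, 6, 7, 5] i)) (hcomm : ∀ (g : G) (y : Y), g • ρ • y = ρ • g • y)
    (hPanti : P ≤ antiWeights (E := X) ρ) (hPst : ∀ g : G, ∀ f ∈ P, (fun x => f (g • x)) ∈ P)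
    (hT : ∀ g : G, ∀ f ∈ P, T (fun x => f (g • x)) = fun y => T f (g • y))
    (hTanti : ∀ f ∈ P, T f ∈ antiWeights (E := Y) ρ) (hTinj : ∀ f ∈ P, T f = 0 → f = 0)
    (h3 : Module.finrank ℚ P = 3) (ha : ∀ i, a (e i) = ![1, 1, 1, -1, -1, -1] i) (haP : a ∈ P) {k : G}
    (hk : (fun x => a (k • x)) = a) : k • e' 0 = e' 0 := by
  have hα := apply_map_orbitVec_ne_zero hsurj hρe hce hsurj' hce' hPanti hPst hT hTinj ha haP
  have hval := apply_map_orbitVec_frame hsurj hce hρe' hce' hT hTanti ha haP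
  -- `a` is fixed by `c`, hence by `c k` and `c² k`
  have hac : ∀ x, a (c • x) = a x := fun x => congrFun (orbitVec_comp_eq hsurj hce ha) x
  have hck : (fun x => a ((c * k) • x)) = a := by
    funext x; rw [mul_smul, hac]; exact congrFun hk x
  have hcck : (fun x => a ((c * c * k) • x)) = a := by
    funext x; rw [mul_smul, mul_smul, hac, hac]; exact congrFun hk x
  have hex := fun {k' : G} (hk' : (fun x => a (k' • x)) = a) =>
    smul_ne_of_orbitVec_comp_eq hsurj hρe hce he' hsurj' hρe' hce' hcomm hPanti hPst hT hTanti hTinj h3 ha haP hk'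
  -- `t (k y₀) = t (y₀)`
  have htk : T a (k • e' 0) = T a (e' 0) := by
    have h := hT k a haP
    rw [hk] at h
    exact (congrFun h (e' 0)).symm
  obtain ⟨π, hπ, -, -⟩ := exists_indexMap he' hsurj' hρe' hcomm k
  have hk0 : k • e' 0 = e' (π 0) := hπ 0
  rw [hk0, hval] at htk
  generalize π 0 = m at hk0 htk
  fin_cases m
  · exact hk0
  · exfalso; simp at htk; exact hα (by linarith)
  · exact absurd hk0 (hex hk).1
  · refine absurd ?_ (hex hcck).1
    rw [mul_smul, mul_smul, hk0, hce', hce']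
    rfl
  · refine absurd ?_ (hex hck).1
    rw [mul_smul, hk0, hce']
    rfl
  · exact absurd hk0 (hex hk).2
  · refine absurd ?_ (hex hcck).2
    rw [mul_smul, mul_smul, hk0, hce', hce']
    rfl
  · refine absurd ?_ (hex hck).2
    rw [mul_smul, hk0, hce']
    rfl

/-! ## §3 The fixed point is a reflex embedding for the orbit type -/

/-- **`Stab(y₀) = Stab(a)`**: `g y₀ = y₀ ⟺ a∘g = a` for every `g ∈ G`. [cite: Shimura1998, §8.3 Prop. 28] -/
theorem smul_eq_iff_orbitVec_comp_eq [MulAction.IsPretransitive G Y] [DecidableEq Y]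
    (hsurj : Function.Surjective e) (hρe : ∀ i, ρ • e i = e (![3, 4, 5, 0, 1, 2] i))
    (hce : ∀ i, c • e i = e (![1, 2, 0, 4, 5, 3] i)) (he' : Function.Injective e')
    (hsurj' : Function.Surjective e') (hρe' : ∀ i, ρ • e' i = e' (![1, 0, 5, 6, 7, 2, 3, 4] i))
    (hce' : ∀ i, c • e' i = e' (![0, 1, 3, 4, 2, 6, 7, 5] i)) (hcomm : ∀ (g : G) (y : Y), g • ρ • y = ρ • g • y)
    (hPanti : P ≤ antiWeights (E := X) ρ) (hPst : ∀ g : G, ∀ f ∈ P, (fun x => f (g • x)) ∈ P)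
    (hT : ∀ g : G, ∀ f ∈ P, T (fun x => f (g • x)) = fun y => T f (g • y))
    (hTanti : ∀ f ∈ P, T f ∈ antiWeights (E := Y) ρ) (hTinj : ∀ f ∈ P, T f = 0 → f = 0)
    (h3 : Module.finrank ℚ P = 3) (ha : ∀ i, a (e i) = ![1, 1, 1, -1, -1, -1] i) (haP : a ∈ P) (g : G) :
    g • e' 0 = e' 0 ↔ (fun x => a (g • x)) = a :=
  ⟨fun hg => orbitVec_comp_eq_of_smul_eq hsurj hρe hce he' hsurj' hρe' hce' hcomm hPanti hPst hT hTanti hTinj ha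
      haP hg,
    fun hk => smul_eq_of_orbitVec_comp_eq hsurj hρe hce he' hsurj' hρe' hce' hcomm hPanti hPst hT hTanti hTinj h3
      ha haP hk⟩

end Summit.HodgeConjecture.CorCM.SexticOctic

end
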